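import Summits.ValiantsHypothesis.ValiantsHypothesis.Theorems.KPlusLogSqLawTropicalBMarkedEdgeComplement

/-!
# Route «KPlusLogSqLaw», crux `TropicalB` (stmt-ValiantsHypothesis-19771) — MARKED-EDGE sector, FOUR-BIT LAW, part 7:
# complementation preserves weights, reflects slopes, transports unique maximisers; THE DUAL LAW (abstract cover form)

HONEST FRAMING.  Helper file (cell `pub-symmetroid`, seat val-sym-trop-p4 (g16), 2026-08-28; `--supports stmt-ValiantsHypothesis-19771
--as helper`).  Kernel version of THEOREM-FOURBIT.md §5 (g15): Proposition (complementation symmetry) and Corollary 3 (DUAL LAW: the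
patterns «`b₃` alone», «`b₁,b₂`», «`b₀,b₂`», «`b₀,b₁`» — slopes `8, 6, 5, 3` for `1,2,4,8` — are never simultaneously dominant, on any
number of nodes), in the abstract cover setting of parts 3–4 and 6.  Nothing here concerns general designs, `TropicalB` in its window,
`WeakLifting`, the doors, `MatrixDescartes` (stmt-ValiantsHypothesis-18050) or VP ≠ VNP.
* `sum_marked` — a function vanishing off the marked nodes sums over the four marked nodes;
* `wC_sum_Fd` / `gC_sum_Fd` — the complemented cover has the same weight and the reflected slope `S − x`;
* `isMax_complement` — a unique maximiser at `θ` complements to a unique maximiser at `−θ` of the enlarged design;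
* `dual_four_bit_law` — **THE DUAL LAW**: loop slopes on the four marked loops only (`0 ≤ g b₀ b₀ < g b₁ b₁ < g b₂ b₂`,
  `g b₁ b₁ + g b₂ b₂ < g b₃ b₃`, all other loops slope `0`), any presence / weights: covers with loop patterns «`b₃` only» / «`b₁,b₂` only» /
  «`b₀,b₂` only» / «`b₀,b₁` only» (among the marked loops) are never all unique maximisers.  Proof: complement (part 6) and apply
  `four_bit_law` (part 4) on `V ⊕ Fin 4`.
-/

set_option linter.dupNamespace false
set_option autoImplicit false

namespace Summit.ValiantsHypothesis.ValiantsHypothesis.Theorems.KPlusLogSqLaw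
namespace MarkedEdge
namespace FourBit

open Finset

variable {V : Type*} [Fintype V] [DecidableEq V]

/-- A function vanishing off the (injectively) marked nodes sums over the marked nodes. [folklore] -/
theorem sum_marked {b : Fin 4 → V} (hb : Function.Injective b) (f : V → ℤ) (hf : ∀ i, (∀ k, b k ≠ i) → f i = 0) :
    ∑ i, f i = ∑ l, f (b l) := by
  rw [← Finset.sum_subset (Finset.subset_univ (Finset.univ.image b)), Finset.sum_image (fun x _ y _ h => hb h)]
  intro i _ hi
  apply hf
  intro k hk
  exact hi (Finset.mem_image.mpr ⟨k, Finset.mem_univ _, hk⟩)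

section Transport

variable {b : Fin 4 → V} (hb : Function.Injective b) {t : V → V ⊕ Fin 4}
  (ht1 : ∀ k, t (b k) = Sum.inr k) (ht2 : ∀ j, (∀ k, b k ≠ j) → t j = Sum.inl j)
  {Fd : Equiv.Perm V → V ⊕ Fin 4 → V ⊕ Fin 4}
  (hF1 : ∀ (σ : Equiv.Perm V) (i : V), (∀ k, b k ≠ i) → Fd σ (Sum.inl i) = t (σ i))
  (hF2 : ∀ (σ : Equiv.Perm V) (l : Fin 4), σ (b l) = b l → Fd σ (Sum.inl (b l)) = Sum.inr l)
  (hF3 : ∀ (σ : Equiv.Perm V) (l : Fin 4), σ (b l) ≠ b l → Fd σ (Sum.inl (b l)) = Sum.inl (b l))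
  (hF4 : ∀ (σ : Equiv.Perm V) (l : Fin 4), σ (b l) = b l → Fd σ (Sum.inr l) = Sum.inl (b l))
  (hF5 : ∀ (σ : Equiv.Perm V) (l : Fin 4), σ (b l) ≠ b l → Fd σ (Sum.inr l) = t (σ (b l)))
  {w : V → V → ℤ} {wC : V ⊕ Fin 4 → V ⊕ Fin 4 → ℤ}
  (hW1 : ∀ i j, wC (Sum.inl i) (Sum.inl j) = if j = i ∧ (∃ l, b l = i) then 0 else w i j)
  (hW2 : ∀ i k, wC (Sum.inl i) (Sum.inr k) = w i (b k))
  (hW3 : ∀ l j, wC (Sum.inr l) (Sum.inl j) = if j = b l then 0 else w (b l) j)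
  (hW4 : ∀ l k, wC (Sum.inr l) (Sum.inr k) = w (b l) (b k))
  {g : V → V → ℤ} (hoff : ∀ i j, j ≠ i → g i j = 0) (hctx0 : ∀ i, (∀ k, b k ≠ i) → g i i = 0)
  {gC : V ⊕ Fin 4 → V ⊕ Fin 4 → ℤ}
  (hG1 : ∀ i j, gC (Sum.inl i) (Sum.inl j) = g i j) (hG2 : ∀ i k, gC (Sum.inl i) (Sum.inr k) = 0) (hG3 : ∀ l v, gC (Sum.inr l) v = 0)

include hb ht1 ht2 hF1 hF2 hF3 hF4 hF5

section Weights
include hW1 hW2 hW3 hW4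

/-- **Complementation preserves the weight of a cover.** [this seat's lemma; THEOREM-FOURBIT.md §5] -/
theorem wC_sum_Fd (σ : Equiv.Perm V) : ∑ u, wC u (Fd σ u) = ∑ i, w i (σ i) := by
  have tinl := t_eq_inl_iff ht1 ht2
  have tinr := t_eq_inr_iff ht1 ht2
  have wt1 : ∀ i j, wC (Sum.inl i) (t j) = w i j := by
    intro i j
    rcases hv : t j with j' | k
    · obtain ⟨hjj, hm⟩ := (tinl _ _).mp hv
      subst hjj
      rw [hW1, if_neg]
      rintro ⟨rfl, ⟨l, hl⟩⟩; exact hm l hl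
    · rw [(tinr _ _).mp hv, hW2]
  have wt2 : ∀ l j, wC (Sum.inr l) (t j) = w (b l) j := by
    intro l j
    rcases hv : t j with j' | k
    · obtain ⟨hjj, hm⟩ := (tinl _ _).mp hv
      subst hjj
      rw [hW3, if_neg (fun h => hm l h.symm)]
    · rw [(tinr _ _).mp hv, hW4]
  rw [Fintype.sum_sum_type]
  -- old-node terms differ from `w i (σ i)` only at marked nodes, where the companion term compensates
  have hdiff : ∑ i, (wC (Sum.inl i) (Fd σ (Sum.inl i)) - w i (σ i)) = ∑ l, (- wC (Sum.inr l) (Fd σ (Sum.inr l))) := by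
    rw [sum_marked hb (fun i => wC (Sum.inl i) (Fd σ (Sum.inl i)) - w i (σ i)) (fun i hm => by
      rw [hF1 σ i hm, wt1]; ring)]
    refine Finset.sum_congr rfl fun l _ => ?_
    by_cases hfix : σ (b l) = b l
    · rw [hF2 σ l hfix, hF4 σ l hfix, hW2, hW3, if_pos rfl, hfix]; ring
    · rw [hF3 σ l hfix, hF5 σ l hfix, hW1, if_pos ⟨rfl, l, rfl⟩, wt2]; ring
  rw [Finset.sum_sub_distrib, Finset.sum_neg_distrib] at hdiff
  linarith

end Weights

section Slopes
include hoff hctx0 hG1 hG2 hG3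

omit hF4 hF5 in
/-- **Complementation reflects the slope of a cover**: new slope + old slope = total marked slope. [this seat's lemma;
THEOREM-FOURBIT.md §5] -/
theorem gC_sum_Fd (σ : Equiv.Perm V) : (∑ u, gC u (Fd σ u)) + ∑ i, g i (σ i) = ∑ l, g (b l) (b l) := by
  have tinl := t_eq_inl_iff ht1 ht2
  have tinr := t_eq_inr_iff ht1 ht2
  have gt : ∀ i j, (∀ k, b k ≠ i) → gC (Sum.inl i) (t j) = 0 := by
    intro i j hm
    rcases hv : t j with j' | k
    · obtain ⟨hjj, -⟩ := (tinl _ _).mp hv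
      subst hjj
      rw [hG1]
      by_cases h : j = i
      · rw [h]; exact hctx0 i hm
      · exact hoff i j h
    · rw [hG2]
  rw [Fintype.sum_sum_type]
  have hr : ∑ l, gC (Sum.inr l) (Fd σ (Sum.inr l)) = 0 := Finset.sum_eq_zero fun l _ => hG3 l _
  rw [hr, add_zero, ← Finset.sum_add_distrib]
  rw [sum_marked hb (fun i => gC (Sum.inl i) (Fd σ (Sum.inl i)) + g i (σ i)) (fun i hm => by
    rw [hF1 σ i hm, gt i (σ i) hm, zero_add]
    by_cases h : σ i = i
    · rw [h]; exact hctx0 i hm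
    · exact hoff i (σ i) h)]
  refine Finset.sum_congr rfl fun l _ => ?_
  by_cases hfix : σ (b l) = b l
  · rw [hF2 σ l hfix, hG2, hfix, zero_add]
  · rw [hF3 σ l hfix, hG1, hoff (b l) (σ (b l)) hfix, add_zero]

end Slopes

variable {ok : V → V → Prop} {okC : V ⊕ Fin 4 → V ⊕ Fin 4 → Prop}
  (hO1 : ∀ i j, okC (Sum.inl i) (Sum.inl j) ↔ ((∀ l, b l ≠ i) ∧ (∀ l, b l ≠ j) ∧ ok i j) ∨ ((∃ l, b l = i) ∧ j = i))
  (hO2 : ∀ i k, okC (Sum.inl i) (Sum.inr k) ↔ ((∀ l, b l ≠ i) ∧ ok i (b k)) ∨ (i = b k ∧ ok (b k) (b k)))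
  (hO3 : ∀ l j, okC (Sum.inr l) (Sum.inl j) ↔ ((∀ k, b k ≠ j) ∧ ok (b l) j) ∨ j = b l)
  (hO4 : ∀ l k, okC (Sum.inr l) (Sum.inr k) ↔ (l ≠ k ∧ ok (b l) (b k)))
include hW1 hW2 hW3 hW4 hoff hctx0 hG1 hG2 hG3 hO1 hO2 hO3 hO4

/-- **Complementation transports unique maximisers** (at `θ` ↦ at `−θ`): scores of the enlarged design are the old scores
shifted by the constant `−θ·S`. [this seat's lemma; THEOREM-FOURBIT.md §5] -/
theorem isMax_complement (σ : Equiv.Perm V) (P : Equiv.Perm (V ⊕ Fin 4)) (hP : ∀ u, P u = Fd σ u) {θ : ℤ}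
    (hσ : (∀ i, ok i (σ i)) ∧ ∀ τ : Equiv.Perm V, τ ≠ σ → (∀ i, ok i (τ i)) →
      ∑ i, (w i (τ i) + θ * g i (τ i)) < ∑ i, (w i (σ i) + θ * g i (σ i))) :
    (∀ u, okC u (P u)) ∧ ∀ τ : Equiv.Perm (V ⊕ Fin 4), τ ≠ P → (∀ u, okC u (τ u)) →
      ∑ u, (wC u (τ u) + (-θ) * gC u (τ u)) < ∑ u, (wC u (P u) + (-θ) * gC u (P u)) := by
  refine ⟨fun u => (hP u).symm ▸ okC_Fd ht1 ht2 hF1 hF2 hF3 hF4 hF5 hO1 hO2 hO3 hO4 σ hσ.1 u, fun τ hτP hτ => ?_⟩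
  obtain ⟨σ', hσ'ok, hσ'⟩ := exists_Fd_eq hb ht1 ht2 hF1 hF2 hF3 hF4 hF5 hO1 hO2 hO3 hO4 τ hτ
  have hne : σ' ≠ σ := by
    rintro rfl
    exact hτP (Equiv.ext fun u => (hσ' u).symm.trans (hP u).symm)
  have hlt := score_lt_of_isMax ok w g hσ hσ'ok hne
  have eWτ : ∑ u, wC u (τ u) = ∑ i, w i (σ' i) := by
    rw [← wC_sum_Fd hb ht1 ht2 hF1 hF2 hF3 hF4 hF5 hW1 hW2 hW3 hW4 σ']
    exact Finset.sum_congr rfl fun u _ => by rw [hσ' u]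
  have eWP : ∑ u, wC u (P u) = ∑ i, w i (σ i) := by
    rw [← wC_sum_Fd hb ht1 ht2 hF1 hF2 hF3 hF4 hF5 hW1 hW2 hW3 hW4 σ]
    exact Finset.sum_congr rfl fun u _ => by rw [hP u]
  have eGτ : (∑ u, gC u (τ u)) + ∑ i, g i (σ' i) = ∑ l, g (b l) (b l) := by
    rw [← gC_sum_Fd hb ht1 ht2 hF1 hF2 hF3 hoff hctx0 hG1 hG2 hG3 σ']
    congr 1
    exact Finset.sum_congr rfl fun u _ => by rw [hσ' u]
  have eGP : (∑ u, gC u (P u)) + ∑ i, g i (σ i) = ∑ l, g (b l) (b l) := by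
    rw [← gC_sum_Fd hb ht1 ht2 hF1 hF2 hF3 hoff hctx0 hG1 hG2 hG3 σ]
    congr 1
    exact Finset.sum_congr rfl fun u _ => by rw [hP u]
  rw [score_eq, score_eq, eWτ, eWP]
  have e1 : (-θ) * ∑ u, gC u (τ u) = -θ * (∑ l, g (b l) (b l)) + θ * ∑ i, g i (σ' i) := by
    rw [← eGτ]; ring
  have e2 : (-θ) * ∑ u, gC u (P u) = -θ * (∑ l, g (b l) (b l)) + θ * ∑ i, g i (σ i) := by
    rw [← eGP]; ring
  rw [e1, e2]
  linarith

end Transport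

/-- **THE DUAL LAW (abstract cover form, every finite node set).**  Marked nodes `b 0, b 1, b 2, b 3` (injective `b`); arc slopes
live on the four marked loops only (`g i j = 0` for `j ≠ i` and for unmarked loops) with `0 ≤ g (b 0) (b 0) < g (b 1) (b 1) < g (b 2) (b 2)`
and `g (b 1) (b 1) + g (b 2) (b 2) < g (b 3) (b 3)`; any arc presence `ok`, any arc weights `w`.  Then covers `D, A, B, C` with the loop
patterns «`b 3` alone», «`b 1, b 2` (not `b 0, b 3`)», «`b 0, b 2`», «`b 0, b 1`» among the marked loops are NEVER all unique maximisers (at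
any parameters).  Proof: complementation (part 6, this file) and `four_bit_law` on `V ⊕ Fin 4`.
[this seat's theorem = THEOREM-FOURBIT.md §5 Corollary 3, kernel version] -/
theorem dual_four_bit_law (ok : V → V → Prop) (w g : V → V → ℤ) {b : Fin 4 → V} (hb : Function.Injective b)
    (hoff : ∀ i j, j ≠ i → g i j = 0) (hctx0 : ∀ i, (∀ k, b k ≠ i) → g i i = 0) (h0 : 0 ≤ g (b 0) (b 0))
    (hs01 : g (b 0) (b 0) < g (b 1) (b 1)) (hs12 : g (b 1) (b 1) < g (b 2) (b 2))
    (hs3 : g (b 1) (b 1) + g (b 2) (b 2) < g (b 3) (b 3))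
    {D A B C : Equiv.Perm V}
    (hD0 : D (b 0) ≠ b 0) (hD1 : D (b 1) ≠ b 1) (hD2 : D (b 2) ≠ b 2) (hD3 : D (b 3) = b 3)
    (hA0 : A (b 0) ≠ b 0) (hA1 : A (b 1) = b 1) (hA2 : A (b 2) = b 2) (hA3 : A (b 3) ≠ b 3)
    (hB0 : B (b 0) = b 0) (hB1 : B (b 1) ≠ b 1) (hB2 : B (b 2) = b 2) (hB3 : B (b 3) ≠ b 3)
    (hC0 : C (b 0) = b 0) (hC1 : C (b 1) = b 1) (hC2 : C (b 2) ≠ b 2) (hC3 : C (b 3) ≠ b 3)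
    {θD θA θB θC : ℤ}
    (hD : (∀ i, ok i (D i)) ∧ ∀ τ : Equiv.Perm V, τ ≠ D → (∀ i, ok i (τ i)) →
      ∑ i, (w i (τ i) + θD * g i (τ i)) < ∑ i, (w i (D i) + θD * g i (D i)))
    (hA : (∀ i, ok i (A i)) ∧ ∀ τ : Equiv.Perm V, τ ≠ A → (∀ i, ok i (τ i)) →
      ∑ i, (w i (τ i) + θA * g i (τ i)) < ∑ i, (w i (A i) + θA * g i (A i)))
    (hB : (∀ i, ok i (B i)) ∧ ∀ τ : Equiv.Perm V, τ ≠ B → (∀ i, ok i (τ i)) →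
      ∑ i, (w i (τ i) + θB * g i (τ i)) < ∑ i, (w i (B i) + θB * g i (B i)))
    (hC : (∀ i, ok i (C i)) ∧ ∀ τ : Equiv.Perm V, τ ≠ C → (∀ i, ok i (τ i)) →
      ∑ i, (w i (τ i) + θC * g i (τ i)) < ∑ i, (w i (C i) + θC * g i (C i))) : False := by
  classical
  -- the redirect map
  let t : V → V ⊕ Fin 4 := fun j =>
    if b 0 = j then Sum.inr 0 else if b 1 = j then Sum.inr 1 else if b 2 = j then Sum.inr 2 else
    if b 3 = j then Sum.inr 3 else Sum.inl j
  have ht1 : ∀ k, t (b k) = Sum.inr k := by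
    intro k
    fin_cases k <;> simp [t, hb.eq_iff]
  have ht2 : ∀ j, (∀ k, b k ≠ j) → t j = Sum.inl j := by
    intro j hj
    simp [t, hj 0, hj 1, hj 2, hj 3]
  -- the complemented cover
  let Fd : Equiv.Perm V → V ⊕ Fin 4 → V ⊕ Fin 4 := fun σ =>
    Sum.elim (fun i => if (∃ l, b l = i) ∧ σ i ≠ i then Sum.inl i else t (σ i))
      (fun l => if σ (b l) = b l then Sum.inl (b l) else t (σ (b l)))
  have hF1 : ∀ (σ : Equiv.Perm V) (i : V), (∀ k, b k ≠ i) → Fd σ (Sum.inl i) = t (σ i) := by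
    intro σ i hm
    simp only [Fd, Sum.elim_inl]
    rw [if_neg]
    rintro ⟨⟨l, hl⟩, -⟩; exact hm l hl
  have hF2 : ∀ (σ : Equiv.Perm V) (l : Fin 4), σ (b l) = b l → Fd σ (Sum.inl (b l)) = Sum.inr l := by
    intro σ l hfix
    simp only [Fd, Sum.elim_inl]
    rw [if_neg (fun h => h.2 hfix), hfix, ht1]
  have hF3 : ∀ (σ : Equiv.Perm V) (l : Fin 4), σ (b l) ≠ b l → Fd σ (Sum.inl (b l)) = Sum.inl (b l) := by
    intro σ l hne
    simp only [Fd, Sum.elim_inl]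
    rw [if_pos ⟨⟨l, rfl⟩, hne⟩]
  have hF4 : ∀ (σ : Equiv.Perm V) (l : Fin 4), σ (b l) = b l → Fd σ (Sum.inr l) = Sum.inl (b l) := by
    intro σ l hfix
    simp only [Fd, Sum.elim_inr]
    rw [if_pos hfix]
  have hF5 : ∀ (σ : Equiv.Perm V) (l : Fin 4), σ (b l) ≠ b l → Fd σ (Sum.inr l) = t (σ (b l)) := by
    intro σ l hne
    simp only [Fd, Sum.elim_inr]
    rw [if_neg hne]
  -- presence, weights, slopes of the enlarged design
  let okC : V ⊕ Fin 4 → V ⊕ Fin 4 → Prop := fun u v =>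
    Sum.elim (fun i => Sum.elim (fun j => ((∀ l, b l ≠ i) ∧ (∀ l, b l ≠ j) ∧ ok i j) ∨ ((∃ l, b l = i) ∧ j = i))
        (fun k => ((∀ l, b l ≠ i) ∧ ok i (b k)) ∨ (i = b k ∧ ok (b k) (b k))) v)
      (fun l => Sum.elim (fun j => ((∀ k, b k ≠ j) ∧ ok (b l) j) ∨ j = b l) (fun k => l ≠ k ∧ ok (b l) (b k)) v) u
  let wC : V ⊕ Fin 4 → V ⊕ Fin 4 → ℤ := fun u v =>
    Sum.elim (fun i => Sum.elim (fun j => if j = i ∧ (∃ l, b l = i) then 0 else w i j) (fun k => w i (b k)) v)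
      (fun l => Sum.elim (fun j => if j = b l then 0 else w (b l) j) (fun k => w (b l) (b k)) v) u
  let gC : V ⊕ Fin 4 → V ⊕ Fin 4 → ℤ := fun u v =>
    Sum.elim (fun i => Sum.elim (fun j => g i j) (fun _ => 0) v) (fun _ => 0) u
  have hO1 : ∀ i j, okC (Sum.inl i) (Sum.inl j) ↔ ((∀ l, b l ≠ i) ∧ (∀ l, b l ≠ j) ∧ ok i j) ∨ ((∃ l, b l = i) ∧ j = i) :=
    fun _ _ => Iff.rfl
  have hO2 : ∀ i k, okC (Sum.inl i) (Sum.inr k) ↔ ((∀ l, b l ≠ i) ∧ ok i (b k)) ∨ (i = b k ∧ ok (b k) (b k)) :=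
    fun _ _ => Iff.rfl
  have hO3 : ∀ l j, okC (Sum.inr l) (Sum.inl j) ↔ ((∀ k, b k ≠ j) ∧ ok (b l) j) ∨ j = b l := fun _ _ => Iff.rfl
  have hO4 : ∀ l k, okC (Sum.inr l) (Sum.inr k) ↔ (l ≠ k ∧ ok (b l) (b k)) := fun _ _ => Iff.rfl
  have hW1 : ∀ i j, wC (Sum.inl i) (Sum.inl j) = if j = i ∧ (∃ l, b l = i) then 0 else w i j := fun _ _ => rfl
  have hW2 : ∀ i k, wC (Sum.inl i) (Sum.inr k) = w i (b k) := fun _ _ => rfl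
  have hW3 : ∀ l j, wC (Sum.inr l) (Sum.inl j) = if j = b l then 0 else w (b l) j := fun _ _ => rfl
  have hW4 : ∀ l k, wC (Sum.inr l) (Sum.inr k) = w (b l) (b k) := fun _ _ => rfl
  have hG1 : ∀ i j, gC (Sum.inl i) (Sum.inl j) = g i j := fun _ _ => rfl
  have hG2 : ∀ i k, gC (Sum.inl i) (Sum.inr k) = 0 := fun _ _ => rfl
  have hG3 : ∀ l v, gC (Sum.inr l) v = 0 := fun _ _ => rfl
  -- the complemented covers as permutations
  have hinj := Fd_injective hb ht1 ht2 hF1 hF2 hF3 hF4 hF5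
  let P : Equiv.Perm V → Equiv.Perm (V ⊕ Fin 4) := fun σ =>
    Equiv.ofBijective (Fd σ) (Finite.injective_iff_bijective.mp (hinj σ))
  have hP : ∀ σ u, P σ u = Fd σ u := fun _ _ => rfl
  have hfix : ∀ σ l, P σ (Sum.inl (b l)) = Sum.inl (b l) ↔ σ (b l) ≠ b l :=
    fun σ l => by rw [hP]; exact Fd_fix_iff hF2 hF3 σ l
  have hmax := fun (σ : Equiv.Perm V) (θ : ℤ) => isMax_complement hb ht1 ht2 hF1 hF2 hF3 hF4 hF5 hW1 hW2 hW3 hW4 hoff hctx0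
    hG1 hG2 hG3 hO1 hO2 hO3 hO4 σ (P σ) (hP σ) (θ := θ)
  -- non-negativity of the marked slopes
  have h1 : 0 ≤ g (b 1) (b 1) := by linarith
  have h2 : 0 ≤ g (b 2) (b 2) := by linarith
  have h3 : 0 ≤ g (b 3) (b 3) := by linarith
  have hdiag : ∀ i, 0 ≤ g i i := by
    intro i
    by_cases hm : ∃ l, b l = i
    · obtain ⟨l, rfl⟩ := hm
      fin_cases l <;> assumption
    · push Not at hm; rw [hctx0 i hm]
  refine four_bit_law (V := V ⊕ Fin 4) okC wC gC ?_ ?_ (b₀ := Sum.inl (b 0)) (b₁ := Sum.inl (b 1)) (b₂ := Sum.inl (b 2))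
    (b₃ := Sum.inl (b 3)) (D := P D) (A := P A) (B := P B) (C := P C) hs01 hs12 hs3
    ((hfix D 0).mpr hD0) ((hfix D 1).mpr hD1) ((hfix D 2).mpr hD2) (fun h => (hfix D 3).mp h hD3)
    ((hfix A 0).mpr hA0) (fun h => (hfix A 1).mp h hA1) (fun h => (hfix A 2).mp h hA2) ((hfix A 3).mpr hA3)
    (fun h => (hfix B 0).mp h hB0) ((hfix B 1).mpr hB1) (fun h => (hfix B 2).mp h hB2) ((hfix B 3).mpr hB3)
    (fun h => (hfix C 0).mp h hC0) (fun h => (hfix C 1).mp h hC1) ((hfix C 2).mpr hC2) ((hfix C 3).mpr hC3)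
    ?_ (hmax D θD hD) (hmax A θA hA) (hmax B θB hB) (hmax C θC hC)
  · -- slopes live on loops
    rintro (i | l) (j | k) hne
    · exact hoff i j fun h => hne (by rw [h])
    · rfl
    · rfl
    · rfl
  · -- and are non-negative
    rintro (i | l)
    · exact hdiag i
    · exact le_rfl
  · -- no context: every other loop of the enlarged design has slope 0
    rintro (i | l) n0 n1 n2 n3 hg
    · exfalso; apply hg
      change g i i = 0
      apply hctx0
      intro k hk
      have e : (Sum.inl i : V ⊕ Fin 4) = Sum.inl (b k) := by rw [hk]
      revert e
      fin_cases k
      · exact n0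
      · exact n1
      · exact n2
      · exact n3
    · exact absurd rfl hg

end FourBit
end MarkedEdge
end Summit.ValiantsHypothesis.ValiantsHypothesis.Theorems.KPlusLogSqLaw
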